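import Literature.Barriers.SmoothPoincare4.GluckTwistsDissolve
import Literature.Topology.FourManifolds.GluckTwistUnknotProofs
import Literature.Topology.FourManifolds.HomotopyBallSliceSphereProofs
import Literature.Topology.FourManifolds.SliceGenusMirrorProofs
import Literature.Topology.FourManifolds.RasmussenMirrorProofs
import HarnessLib

/-!
# MMSW 2023, Cor. 1.13 for knots: what it contains and what is left (sibling of `GluckTwistsDissolve.lean`)

Sibling proof file of `Literature/Barriers/SmoothPoincare4/GluckTwistsDissolve.lean` for its named fact
`Literature.Barriers.SmoothPoincare4.rasmussen_eq_zero_of_isSliceDiscIn_gluckTwist` — Manolescu–Marengon–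
Sarkar–Willis, *A generalization of Rasmussen's invariant, with applications to surfaces in some
four-manifolds*, Duke Math. J. 172 (2023), **Cor. 1.13 (= Cor. 6.15)**, knot case: *"Let `X` be a homotopy
4-sphere obtained by a Gluck twist on a 2-knot in `S⁴`. If a link `L ⊂ S³` is strongly slice in `X`, then
`s(L) = 1 - |L|`."* Everything here is **proved**; no definition and no named fact is introduced (D-0026).
The fact itself is NOT discharged: its printed proof (p. 19 of arXiv:1910.08195v3) reads

> *By a property of Gluck twists, `X # ℂℙ² ≅ ℂℙ²` and `X # ℂℙ²bar ≅ ℂℙ²bar`; cf. [GS]. Thus, `L` is strongly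
> H-slice in `ℂℙ²` and in `ℂℙ²bar`. It follows that `L` and `L̄` are strongly H-slice in `ℂℙ²bar`. By
> Corollary 6.13, `s(L) ≤ 1 - ℓ` and `s(L̄) ≤ 1 - ℓ`, where `ℓ = |L|`. These are precisely Equations (6.1)
> and (6.2). We then conclude the proof as in Theorem 6.14.*

and Corollary 6.13 (*"If `L` is strongly H-slice in `#ᵗ ℂℙ²bar`, then `s(L) ≤ 1 - |L|`"*) rests on the
adjunction inequality for `s` (Cor. 1.9, Thm. 1.8), i.e. on the maps induced on Lee homology by link
cobordisms (Rasmussen 2010, §4; Beliakova–Wehrli 2008) and on MMSW's `s`-invariant of null-homologous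
links in `#ʳ S¹ × S²` (§§3–5, the value `s(F_p(1)) = 1 - 2p`, Thm. 1.7). None of this is in the tree
(its `GaussDiagram`/Lee complex is knots-only and has no cobordism maps — the same gap that keeps
Rasmussen's `Literature.Topology.FourManifolds.eq_zero_of_isSmoothlySlice` a named fact, see
`RasmussenSliceProofs.lean`).

## What is proved here

* `rasmussen_eq_zero_of_isSliceDiscIn_gluckTwist.eq_zero_of_isSmoothlySlice` — **the case `X = S⁴`
  is Rasmussen's theorem**: the fact implies the named fact
  `Literature.Topology.FourManifolds.eq_zero_of_isSmoothlySlice` (`s(K) = 0` for smoothly slice `K`;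
  Rasmussen 2010, Thm. 1; = MMSW Thm. 6.14 for knots), because `S⁴` is the Gluck twist of the unknotted
  2-sphere (tree theorem `isGluckTwist_sphere_unknotTwo_holds`, Gluck 1962, §17) and a slice disc in
  `B⁴` is a slice disc in `S⁴ ∖ B̊⁴` (tree theorem `Knot.IsSliceDisc.isSliceDiscIn_sphere`). So the fact
  is at least as strong as Rasmussen's slice theorem, formally.
* `Literature.Topology.FourManifolds.Knot.IsSliceDiscIn.mirror` — **sliceness in `X` in the tree's
  orientation-free sense is closed under mirror image**: if `K` bounds a proper smooth disc in
  `X ∖ e(B̊⁴)` then `K.mirror` bounds the same disc in `X ∖ e'(B̊⁴)` for the reflected ball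
  `e' = e ∘ ρ`, `ρ = reflectLastCLM 3` the reflection of `ℝ⁴` in the last coordinate (which restricts
  to `reflectLast 3` on `S³`, the reflection defining `Knot.mirror`). This is the tree-level form of
  *"`L` is strongly H-slice in `ℂℙ²bar` if and only if `L̄` is strongly slice in `ℂℙ²`"* (MMSW
  2023, §6.1, Remark 6.6: orientation reversal exchanges `L` and `L̄`), the unoriented `X` standing
  for both `X` and `X̄`.
* `rasmussen_eq_zero_of_isSliceDiscIn_gluckTwist_of_nonpos` — **"conclude as in Theorem 6.14"**:
  the fact follows from the ONE-SIDED bound *"`s ≤ 0` for every knot slice (tree sense) in a Gluck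
  twist of `S⁴`"* — which is what dissolution (`X # ℂℙ²bar ≅ ℂℙ²bar`) and Cor. 6.13 deliver,
  Equation (6.1) of the source — together with the mirror formula `s(K̄) = -s(K)` (the tree's named
  fact `Literature.Topology.FourManifolds.HasRasmussenInvariant.mirror`, Rasmussen 2010, §3.5,
  entering as a hypothesis, D-0014): apply the bound to `K` and, by `IsSliceDiscIn.mirror`, to
  `K.mirror`. This is the exact interface the missing adjunction-inequality layer has to meet.
* `rasmussen_eq_zero_of_isSliceDiscIn_gluckTwist_of_nonpos'`,
  `rasmussen_eq_zero_of_isSliceDiscIn_gluckTwist_iff_nonpos'` — the same, UNCONDITIONALLY: the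
  mirror formula is now the tree theorem `HasRasmussenInvariant.mirror_holds`
  (`RasmussenMirrorProofs.lean`), so the named fact is equivalent, with no hypothesis, to the
  one-sided bound *"`s ≤ 0` for every knot slice (tree sense) in a Gluck twist of `S⁴`"* —
  Equation (6.1) of the source for Gluck twists, i.e. dissolution plus Cor. 6.13.

## References

* C. Manolescu, M. Marengon, S. Sarkar, M. Willis, *A generalization of Rasmussen's invariant, with
  applications to surfaces in some four-manifolds*, Duke Math. J. 172 (2023) 231–311
  (arXiv:1910.08195): Cor. 1.13 = Cor. 6.15 and its proof, Def. 6.2, Remark 6.6, Cor. 6.13, Thm. 6.14, §9.3.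
  [cite: ManolescuMarengonSarkarWillis2023, Cor. 1.13]
* J. Rasmussen, *Khovanov homology and the slice genus*, Invent. Math. 182 (2010) 419–447: Thm. 1,
  §3.5 (mirror), §4 (cobordism maps). [cite: Rasmussen2010, Thm. 1]
* H. Gluck, *The embedding of two-spheres in the four-sphere*, Trans. AMS 104 (1962), §17.
  [cite: GluckTAMS1962, §17]

## Design notes

No definitions, no named facts, no instances. The reflected ball is written with the tree's
continuous linear map `reflectLastCLM 3` (`KnotsProofs.lean`; norm-preserving,
`norm_reflectLastCLM`, `SliceGenusMirrorProofs.lean`), turned into a diffeomorphism of `ℝ⁴` inside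
the proof only (`ContinuousLinearEquiv.equivOfInverse … |>.toDiffeomorph`) to invoke the tree's
`Manifold.IsSmoothEmbedding.comp_diffeomorph` (`CerfGammaFourProofs.lean`). The instance binder
`[SphereEmbedding.SmoothnessFacts]` of `Knot.mirror`, `unknotTwo` and `HasRasmussenInvariant.mirror`
is discharged by the tree's instance `SphereEmbedding.smoothnessFacts` (`KnotsProofs.lean`).
-/

noncomputable section

open scoped Manifold ContDiff Topology
open Function Set

namespace Literature.Topology.FourManifolds

/-! ### The ambient reflection of `ℝ⁴` -/

/-- The coordinate reflection `reflectLastCLM n` of `ℝⁿ⁺¹` is an involution. [folklore] -/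
theorem reflectLastCLM_reflectLastCLM (n : ℕ) (v : EuclideanSpace ℝ (Fin (n + 1))) :
    reflectLastCLM n (reflectLastCLM n v) = v := by
  ext i
  simp only [reflectLastCLM, ContinuousLinearMap.coe_mk', LinearMap.coe_mk, AddHom.coe_mk,
    PiLp.toLp_apply]
  split_ifs <;> simp

/-- The coordinate reflection `reflectLastCLM n` of `ℝⁿ⁺¹` maps the closed unit ball into itself
(it is norm-preserving, `norm_reflectLastCLM`). [folklore] -/
theorem reflectLastCLM_mem_closedBall {n : ℕ} {v : EuclideanSpace ℝ (Fin (n + 1))}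
    (hv : v ∈ Metric.closedBall (0 : EuclideanSpace ℝ (Fin (n + 1))) 1) :
    reflectLastCLM n v ∈ Metric.closedBall (0 : EuclideanSpace ℝ (Fin (n + 1))) 1 := by
  rw [mem_closedBall_zero_iff] at hv ⊢
  rwa [norm_reflectLastCLM]

/-- A smooth embedding `e : ℝⁿ⁺¹ → X` precomposed with the coordinate reflection `reflectLastCLM n`
is a smooth embedding (the reflection is a linear involution, hence a diffeomorphism of `ℝⁿ⁺¹`;
tree lemma `Manifold.IsSmoothEmbedding.comp_diffeomorph`). [folklore] -/
theorem isSmoothEmbedding_comp_reflectLastCLM {n : ℕ} {X : Type*} [TopologicalSpace X]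
    [ChartedSpace (EuclideanSpace ℝ (Fin (n + 1))) X] {e : EuclideanSpace ℝ (Fin (n + 1)) → X}
    (he : Manifold.IsSmoothEmbedding (𝓡 (n + 1)) (𝓡 (n + 1)) ∞ e) :
    Manifold.IsSmoothEmbedding (𝓡 (n + 1)) (𝓡 (n + 1)) ∞ (e ∘ reflectLastCLM n) := by
  let R : EuclideanSpace ℝ (Fin (n + 1)) ≃L[ℝ] EuclideanSpace ℝ (Fin (n + 1)) :=
    ContinuousLinearEquiv.equivOfInverse (reflectLastCLM n) (reflectLastCLM n)
      (reflectLastCLM_reflectLastCLM n) (reflectLastCLM_reflectLastCLM n)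
  exact he.comp_diffeomorph R.toDiffeomorph

namespace Knot

/-! ### Sliceness in `X` (orientation-free) is mirror-closed -/

/-- **The mirror of a knot slice in `X ∖ B̊⁴` is slice in `X ∖ B̊'⁴` for the reflected ball.** If
`K.IsSliceDiscIn X e f` (the disc `f|_{𝔻²}` is a proper smooth slice disc for `K` in `X ∖ e(B̊⁴)`),
then the SAME disc is a slice disc for `K.mirror = reflectLast 3 ∘ K` with respect to the reflected
ball embedding `e ∘ ρ`, `ρ = reflectLastCLM 3`: `ρ` is a norm-preserving linear involution of `ℝ⁴`,
so `e ∘ ρ` is again a smooth embedding with `(e ∘ ρ)(𝔻⁴) = e(𝔻⁴)`, and on `S¹`,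
`f = e ∘ K = (e ∘ ρ) ∘ (ρ ∘ K) = (e ∘ ρ) ∘ K.mirror`. Since the tree's `IsSliceDiscIn` lets the ball
`e` have either orientation, "slice in `X`" here means "slice in `X` or in `X̄`" in the oriented
sense, and this lemma is the tree form of the orientation-reversal remark *"`L` is strongly H-slice in
`ℂℙ²bar` if and only if `L̄` is strongly slice in `ℂℙ²`"*.
[cite: ManolescuMarengonSarkarWillis2023, §6.1, Remark 6.6] -/
theorem IsSliceDiscIn.mirror {K : Knot} {X : Type*} [TopologicalSpace X]
    [ChartedSpace (EuclideanSpace ℝ (Fin 4)) X] {e : EuclideanSpace ℝ (Fin 4) → X}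
    {f : EuclideanSpace ℝ (Fin 2) → X} (h : K.IsSliceDiscIn X e f) :
    K.mirror.IsSliceDiscIn X (e ∘ reflectLastCLM 3) f := by
  obtain ⟨he, hf, hinj, hmf, hproper, hbdry⟩ := h
  refine ⟨isSmoothEmbedding_comp_reflectLastCLM he, hf, hinj, hmf, ?_, ?_⟩
  · -- properness: `(e ∘ ρ)(𝔻⁴) ⊆ e(𝔻⁴)`
    rintro x hx ⟨y, hy, hxy⟩
    exact hproper x hx ⟨reflectLastCLM 3 y, reflectLastCLM_mem_closedBall hy, hxy⟩
  · -- boundary values: `f = (e ∘ ρ) ∘ K.mirror` on `S¹`, as `ρ ∘ ρ = id`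
    intro x
    rw [hbdry x, SphereEmbedding.coe_mirror, Function.comp_apply, Function.comp_apply,
      coe_reflectLast, reflectLastCLM_reflectLastCLM]

/-- Orientation-free sliceness in `X` is mirror-invariant: `K` bounds a proper smooth disc in the
complement of some smooth ball of `X` iff `K.mirror` does. [cite: ManolescuMarengonSarkarWillis2023, §6.1, Remark 6.6] -/
theorem exists_isSliceDiscIn_mirror_iff (K : Knot) (X : Type*) [TopologicalSpace X]
    [ChartedSpace (EuclideanSpace ℝ (Fin 4)) X] :
    (∃ (e : EuclideanSpace ℝ (Fin 4) → X) (f : EuclideanSpace ℝ (Fin 2) → X),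
        K.mirror.IsSliceDiscIn X e f) ↔
      ∃ (e : EuclideanSpace ℝ (Fin 4) → X) (f : EuclideanSpace ℝ (Fin 2) → X),
        K.IsSliceDiscIn X e f := by
  constructor
  · rintro ⟨e, f, h⟩
    have h' : K.mirror.mirror.IsSliceDiscIn X (e ∘ reflectLastCLM 3) f := h.mirror
    rw [show K.mirror.mirror = K from SphereEmbedding.mirror_mirror K] at h'
    exact ⟨e ∘ reflectLastCLM 3, f, h'⟩
  · rintro ⟨e, f, h⟩
    exact ⟨e ∘ reflectLastCLM 3, f, h.mirror⟩

end Knot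

end Literature.Topology.FourManifolds

namespace Literature.Barriers.SmoothPoincare4

open Literature.Topology.FourManifolds

/-! ### The case `X = S⁴`: Rasmussen's slice theorem -/

/-- **Cor. 1.13 contains Rasmussen's theorem `s(slice knot) = 0`.** GIVEN the named fact
`rasmussen_eq_zero_of_isSliceDiscIn_gluckTwist` (MMSW 2023, Cor. 1.13 for knots), every smoothly
slice knot has `s = 0`, i.e. the named fact `Literature.Topology.FourManifolds.eq_zero_of_isSmoothlySlice`
(Rasmussen 2010, Thm. 1; MMSW 2023, Thm. 6.14 for `|L| = 1`) holds: `S⁴` is the Gluck twist of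
`S⁴` along the unknotted 2-sphere (`isGluckTwist_sphere_unknotTwo_holds`, Gluck 1962, §17), and a
slice disc `g` for `K` in `B⁴` becomes a proper slice disc in `S⁴ ∖ c⁻¹(B̊⁴)` for the inverse
stereographic chart `c⁻¹` at `a = (1,0,0,0,0)` (`Knot.IsSliceDisc.isSliceDiscIn_sphere`). MMSW
prove Cor. 6.15 by generalising their proof of Thm. 6.14; this records the converse containment.
[cite: ManolescuMarengonSarkarWillis2023, Cor. 1.13 and Thm. 6.14] [cite: Rasmussen2010, Thm. 1]
[cite: GluckTAMS1962, §17] -/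
theorem rasmussen_eq_zero_of_isSliceDiscIn_gluckTwist.eq_zero_of_isSmoothlySlice
    (h : rasmussen_eq_zero_of_isSliceDiscIn_gluckTwist) : eq_zero_of_isSmoothlySlice := by
  intro K s hs hK
  obtain ⟨g, hg⟩ := hK
  exact h unknotTwo (Metric.sphere (0 : EuclideanSpace ℝ (Fin 5)) 1)
    isGluckTwist_sphere_unknotTwo_holds K _ _
    (hg.isSliceDiscIn_sphere ⟨EuclideanSpace.single 0 1, by simp⟩) s hs

/-! ### "Conclude as in Theorem 6.14": the fact from the one-sided bound -/

/-- **MMSW 2023, proof of Cor. 6.15, last step.** The named fact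
`rasmussen_eq_zero_of_isSliceDiscIn_gluckTwist` follows from
* the mirror formula `s(K̄) = -s(K)` (the tree's named fact `HasRasmussenInvariant.mirror`,
  Rasmussen 2010, §3.5; hypothesis `hmirror`), and
* the ONE-SIDED bound (hypothesis `hle`): every knot `K` which is slice, in the tree's
  orientation-free sense `Knot.IsSliceDiscIn`, in a (Hausdorff, second countable) smooth Gluck twist
  `X` of `S⁴` has `s(K) ≤ 0` — in the source this is Equation (6.1), obtained from
  `X # ℂℙ²bar ≅ ℂℙ²bar` (so `K` is H-slice in `ℂℙ²bar`) and Cor. 6.13 (`s(L) ≤ 1 - |L|` for links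
  strongly H-slice in `#ᵗ ℂℙ²bar`), for both orientations of `X` (the class of Gluck twists is
  closed under orientation reversal).
Proof, as printed ("conclude as in Theorem 6.14"): `hle` gives `s(K) ≤ 0`; the same disc is a slice
disc for `K.mirror` with respect to the reflected ball (`Knot.IsSliceDiscIn.mirror`), and
`s(K.mirror) = -s(K)`, so `hle` also gives `-s(K) ≤ 0`.
[cite: ManolescuMarengonSarkarWillis2023, proof of Cor. 6.15 and Thm. 6.14] [cite: Rasmussen2010, §3.5] -/
theorem rasmussen_eq_zero_of_isSliceDiscIn_gluckTwist_of_nonpos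
    (hmirror : HasRasmussenInvariant.mirror)
    (hle : ∀ (K₂ : TwoKnot) (X : Type) [TopologicalSpace X] [T2Space X] [SecondCountableTopology X]
      [ChartedSpace (EuclideanSpace ℝ (Fin 4)) X] [IsManifold (𝓡 4) ∞ X]
      (_hX : IsGluckTwist (𝓡 4) X K₂) (K : Knot) (e : EuclideanSpace ℝ (Fin 4) → X)
      (f : EuclideanSpace ℝ (Fin 2) → X) (_hK : K.IsSliceDiscIn X e f)
      (s : ℤ) (_hs : K.HasRasmussenInvariant s), s ≤ 0) :
    rasmussen_eq_zero_of_isSliceDiscIn_gluckTwist := by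
  intro K₂ X _ _ _ _ _ hX K e f hK s hs
  have h₁ : s ≤ 0 := hle K₂ X hX K e f hK s hs
  have h₂ : -s ≤ 0 := hle K₂ X hX K.mirror _ f hK.mirror (-s) (hmirror hs)
  omega

/-- The one-sided bound of `rasmussen_eq_zero_of_isSliceDiscIn_gluckTwist_of_nonpos` is also
necessary (trivially), so GIVEN the mirror formula the named fact is EQUIVALENT to it: the whole
content of MMSW 2023, Cor. 1.13 (knot case) beyond Rasmussen 2010, §3.5 is Equation (6.1) for Gluck
twists. [cite: ManolescuMarengonSarkarWillis2023, proof of Cor. 6.15] -/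
theorem rasmussen_eq_zero_of_isSliceDiscIn_gluckTwist_iff_nonpos
    (hmirror : HasRasmussenInvariant.mirror) :
    rasmussen_eq_zero_of_isSliceDiscIn_gluckTwist ↔
      ∀ (K₂ : TwoKnot) (X : Type) [TopologicalSpace X] [T2Space X] [SecondCountableTopology X]
        [ChartedSpace (EuclideanSpace ℝ (Fin 4)) X] [IsManifold (𝓡 4) ∞ X]
        (_hX : IsGluckTwist (𝓡 4) X K₂) (K : Knot) (e : EuclideanSpace ℝ (Fin 4) → X)
        (f : EuclideanSpace ℝ (Fin 2) → X) (_hK : K.IsSliceDiscIn X e f)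
        (s : ℤ) (_hs : K.HasRasmussenInvariant s), s ≤ 0 :=
  ⟨fun h K₂ X _ _ _ _ _ hX K e f hK s hs ↦ (h K₂ X hX K e f hK s hs).le,
    rasmussen_eq_zero_of_isSliceDiscIn_gluckTwist_of_nonpos hmirror⟩

/-! ### Unconditional forms (the mirror formula is a theorem of the tree) -/

/-- **MMSW 2023, proof of Cor. 6.15, last step — unconditionally.** The named fact
`rasmussen_eq_zero_of_isSliceDiscIn_gluckTwist` follows from the one-sided bound alone: every knot
slice (tree sense, `Knot.IsSliceDiscIn`) in a smooth Gluck twist of `S⁴` has `s ≤ 0` (Equation (6.1)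
of the source: dissolution `X # ℂℙ²bar ≅ ℂℙ²bar` and Cor. 6.13). The mirror formula
`s(K̄) = -s(K)` used to symmetrise is the tree theorem `HasRasmussenInvariant.mirror_holds`
(Rasmussen 2010, §3.5). [cite: ManolescuMarengonSarkarWillis2023, proof of Cor. 6.15]
[cite: Rasmussen2010, §3.5] -/
theorem rasmussen_eq_zero_of_isSliceDiscIn_gluckTwist_of_nonpos'
    (hle : ∀ (K₂ : TwoKnot) (X : Type) [TopologicalSpace X] [T2Space X] [SecondCountableTopology X]
      [ChartedSpace (EuclideanSpace ℝ (Fin 4)) X] [IsManifold (𝓡 4) ∞ X]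
      (_hX : IsGluckTwist (𝓡 4) X K₂) (K : Knot) (e : EuclideanSpace ℝ (Fin 4) → X)
      (f : EuclideanSpace ℝ (Fin 2) → X) (_hK : K.IsSliceDiscIn X e f)
      (s : ℤ) (_hs : K.HasRasmussenInvariant s), s ≤ 0) :
    rasmussen_eq_zero_of_isSliceDiscIn_gluckTwist :=
  rasmussen_eq_zero_of_isSliceDiscIn_gluckTwist_of_nonpos HasRasmussenInvariant.mirror_holds hle

/-- **What is left of MMSW 2023, Cor. 1.13 (knot case), exactly.** With no hypothesis, the named
fact `rasmussen_eq_zero_of_isSliceDiscIn_gluckTwist` is EQUIVALENT to the one-sided bound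
*"`s ≤ 0` for every knot slice (tree sense) in a smooth Gluck twist of `S⁴`"*: the content of
Cor. 1.13 beyond the tree is Equation (6.1) of its proof for Gluck twists — the dissolution
`X # ℂℙ²bar ≅ ℂℙ²bar` together with Cor. 6.13 (`s(L) ≤ 1 - |L|` for links strongly H-slice in
`#ᵗ ℂℙ²bar`, from the adjunction inequality for `s`).
[cite: ManolescuMarengonSarkarWillis2023, proof of Cor. 6.15 and Cor. 6.13] -/
theorem rasmussen_eq_zero_of_isSliceDiscIn_gluckTwist_iff_nonpos' :
    rasmussen_eq_zero_of_isSliceDiscIn_gluckTwist ↔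
      ∀ (K₂ : TwoKnot) (X : Type) [TopologicalSpace X] [T2Space X] [SecondCountableTopology X]
        [ChartedSpace (EuclideanSpace ℝ (Fin 4)) X] [IsManifold (𝓡 4) ∞ X]
        (_hX : IsGluckTwist (𝓡 4) X K₂) (K : Knot) (e : EuclideanSpace ℝ (Fin 4) → X)
        (f : EuclideanSpace ℝ (Fin 2) → X) (_hK : K.IsSliceDiscIn X e f)
        (s : ℤ) (_hs : K.HasRasmussenInvariant s), s ≤ 0 :=
  rasmussen_eq_zero_of_isSliceDiscIn_gluckTwist_iff_nonpos HasRasmussenInvariant.mirror_holds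

end Literature.Barriers.SmoothPoincare4

end
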